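import Summits.MatrixMultiplication.MatrixMultiplication.Theses.FourierTwoFamilies

/-!
# Refutation of `FourierTwoFamilies.PrimeCyclicWall` (stmt-MatrixMultiplication-5964)

The gen-1 item claimed an absolute `C` with `n·s² ≤ C·p` for every balanced SDPP configuration in
`ℤ/pℤ`.  False, by the **radix-`M` digit design** living directly in cyclic groups: for `S ⊆ Fin 2l`,
`|S| = l`, `A_S = {Σ_{t∈S} x_t M^t : x_t ∈ [2,M-1]}`, `B_S = {−Σ_{t∉S} y_t M^t : y_t ∈ [2,M-1]}` —
`binom(2l,l)` pairs of size `(M-2)^l`, SDPP in `ZMod p` for `p ≥ 2M^{2l}`: a relation between images is a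
digit identity `x + y' = x' + y` in `ℕ`; for (W) both sides have digits `≤ M-1`; for (X), `S ≠ V` gives a
zero digit `t₀ ∈ V ∖ S` of `x + y'`, and mod `M^{t₀+1}` the left side is `< 2M^{t₀} ≤` the right side
(digits of `x' + y` lie in `[2,M-1]`; the excluded digits `0,1` absorb the carry).  `M = 9`, Bertrand
`p ≤ 4·81^l`: `n·s² ≥ 98^l > 4C·81^l ≥ C·p` by Bernoulli.  Density `≈ s^{-0.546}`: densest cyclic SDPP
designs known here (also refuter rattack-14311's `digit_design.py`; CKSU 2005 Prop. 24 is the torus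
version); caps the live crux `FourierTwoFamiliesModP.PrimeCyclicPowerGain` (stmt-14309) at `c < 0.546`.
-/

namespace Summit.MatrixMultiplication.MatrixMultiplication.Theorems

open Finset

/-- digit sums: `dsum M f k = Σ_{t<k} f t * M^t`. -/
private def dsum (M : ℕ) (f : ℕ → ℕ) (k : ℕ) : ℕ := ∑ t ∈ range k, f t * M ^ t
/-- (helper for the digit design) [folklore] -/
private lemma dsum_succ (M : ℕ) (f : ℕ → ℕ) (k : ℕ) : dsum M f (k + 1) = dsum M f k + f k * M ^ k := by
  simp [dsum, sum_range_succ]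

/-- digits `≤ M-1` ⇒ `dsum < M^k` (needs `1 ≤ M`). -/
private lemma dsum_lt_pow {M : ℕ} (hM : 1 ≤ M) (f : ℕ → ℕ) (k : ℕ) (hf : ∀ t < k, f t ≤ M - 1) :
    dsum M f k < M ^ k := by
  induction k with
  | zero => simp [dsum]
  | succ k ih =>
    rw [dsum_succ]
    have h1 := ih (fun t ht => hf t (by omega))
    have h2 : f k * M ^ k ≤ (M - 1) * M ^ k := Nat.mul_le_mul_right _ (hf k (by omega))
    have h3 : (M - 1) * M ^ k + M ^ k = M ^ (k + 1) := by
      rw [pow_succ]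
      have : (M - 1) * M ^ k + M ^ k = (M - 1 + 1) * M ^ k := by ring
      rw [this, Nat.sub_add_cancel hM, mul_comm]
    omega

/-- digits `≤ 2M-2` ⇒ `dsum + 2 ≤ 2 M^k` (needs `1 ≤ M`). -/
private lemma dsum_add_two_le {M : ℕ} (hM : 1 ≤ M) (f : ℕ → ℕ) (k : ℕ) (hf : ∀ t < k, f t ≤ 2 * M - 2) :
    dsum M f k + 2 ≤ 2 * M ^ k := by
  induction k with
  | zero => simp [dsum]
  | succ k ih =>
    rw [dsum_succ]
    have h1 := ih (fun t ht => hf t (by omega))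
    have h2 : f k * M ^ k ≤ (2 * M - 2) * M ^ k := Nat.mul_le_mul_right _ (hf k (by omega))
    have h3 : (2 * M - 2) * M ^ k + 2 * M ^ k = 2 * M ^ (k + 1) := by
      rw [pow_succ]
      have : (2 * M - 2) * M ^ k + 2 * M ^ k = (2 * M - 2 + 2) * M ^ k := by ring
      rw [this]
      have : 2 * M - 2 + 2 = 2 * M := by omega
      rw [this]; ring
    omega

/-- truncation: `dsum M f d ≡ dsum M f k (mod M^k)` for `k ≤ d`. -/
private lemma dsum_mod_pow (M : ℕ) (f : ℕ → ℕ) {k d : ℕ} (hkd : k ≤ d) :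
    dsum M f d % M ^ k = dsum M f k % M ^ k := by
  have hsplit : dsum M f d = dsum M f k + ∑ t ∈ Ico k d, f t * M ^ t := by
    simp only [dsum]; rw [← sum_range_add_sum_Ico _ hkd]
  have hdvd : M ^ k ∣ ∑ t ∈ Ico k d, f t * M ^ t := by
    apply dvd_sum
    intro t ht
    exact Dvd.dvd.mul_left (pow_dvd_pow M (mem_Ico.mp ht).1) _
  obtain ⟨q, hq⟩ := hdvd
  rw [hsplit, hq, Nat.add_mul_mod_self_left]

/-- **separation**: a digit vector `c` (digits `≤ 2M-2`) with a zero digit at `t₀ < d` and a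
vector `z` with all digits in `[2, M-1]` have different digit sums (compare modulo `M^(t₀+1)`:
the `c`-side is `< 2M^t₀`, the `z`-side is `≥ 2M^t₀`). Needs `2 ≤ M`. -/
private lemma dsum_ne_of_zero_digit {M d t₀ : ℕ} (hM : 2 ≤ M) (ht₀ : t₀ < d) (c z : ℕ → ℕ)
    (hc : ∀ t < d, c t ≤ 2 * M - 2) (hc0 : c t₀ = 0) (hz : ∀ t < d, 2 ≤ z t ∧ z t ≤ M - 1) :
    dsum M c d ≠ dsum M z d := by
  intro heq
  have hmod : dsum M c d % M ^ (t₀ + 1) = dsum M z d % M ^ (t₀ + 1) := by rw [heq]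
  rw [dsum_mod_pow M c (by omega : t₀ + 1 ≤ d), dsum_mod_pow M z (by omega : t₀ + 1 ≤ d),
    dsum_succ, dsum_succ, hc0, zero_mul, add_zero] at hmod
  have hL : dsum M c t₀ + 2 ≤ 2 * M ^ t₀ :=
    dsum_add_two_le (by omega) c t₀ (fun t ht => hc t (by omega))
  have hR : dsum M z t₀ + z t₀ * M ^ t₀ < M ^ (t₀ + 1) := by
    have := dsum_lt_pow (M := M) (by omega) z (t₀ + 1) (fun t ht => (hz t (by omega)).2)
    rwa [dsum_succ] at this
  have hpow : 2 * M ^ t₀ ≤ M ^ (t₀ + 1) := by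
    rw [pow_succ, mul_comm]; exact Nat.mul_le_mul_left _ hM
  have hLlt : dsum M c t₀ < M ^ (t₀ + 1) := by omega
  rw [Nat.mod_eq_of_lt hLlt, Nat.mod_eq_of_lt hR] at hmod
  have hz2 : 2 * M ^ t₀ ≤ z t₀ * M ^ t₀ := Nat.mul_le_mul_right _ (hz t₀ ht₀).1
  omega

/-- **uniqueness of digits**: digit vectors with digits `< M` and equal digit sums agree below `d`. -/
private lemma digits_eq_of_dsum_eq {M : ℕ} (hM : 1 ≤ M) :
    ∀ (d : ℕ) (x y : ℕ → ℕ), (∀ t < d, x t ≤ M - 1) → (∀ t < d, y t ≤ M - 1) →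
      dsum M x d = dsum M y d → ∀ t < d, x t = y t := by
  intro d
  induction d with
  | zero => intro x y _ _ _ t ht; omega
  | succ d ih =>
    intro x y hx hy heq t ht
    rw [dsum_succ, dsum_succ] at heq
    have hxd : dsum M x d < M ^ d := dsum_lt_pow hM x d (fun t ht => hx t (by omega))
    have hyd : dsum M y d < M ^ d := dsum_lt_pow hM y d (fun t ht => hy t (by omega))
    have hmod := congrArg (· % M ^ d) heq
    simp only [Nat.add_mul_mod_self_right, Nat.mod_eq_of_lt hxd, Nat.mod_eq_of_lt hyd] at hmod
    -- hmod : dsum M x d = dsum M y d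
    have htop : x d * M ^ d = y d * M ^ d := by omega
    have hMd : 0 < M ^ d := Nat.pos_of_ne_zero (pow_ne_zero d (by omega))
    rcases Nat.lt_succ_iff_lt_or_eq.mp ht with hlt | rfl
    · exact ih x y (fun t ht => hx t (by omega)) (fun t ht => hy t (by omega)) hmod t hlt
    · exact Nat.eq_of_mul_eq_mul_right hMd htop

/-- additivity of digit sums. -/
private lemma dsum_add (M : ℕ) (f g : ℕ → ℕ) (k : ℕ) :
    dsum M (fun t => f t + g t) k = dsum M f k + dsum M g k := by
  simp [dsum, add_mul, sum_add_distrib]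


/-! ## The radix-`M` digit design -/

section Design

variable (M d : ℕ)

/-- extend a digit vector on `Fin d` by zero. -/
private def ext (x : Fin d → ℕ) : ℕ → ℕ := fun t => if h : t < d then x ⟨t, h⟩ else 0
/-- (helper for the digit design) [folklore] -/
private lemma ext_apply_fin (x : Fin d → ℕ) (t : Fin d) : ext d x t = x t := by
  simp [ext, t.isLt]
/-- (helper for the digit design) [folklore] -/
private lemma ext_apply_lt (x : Fin d → ℕ) {t : ℕ} (ht : t < d) : ext d x t = x ⟨t, ht⟩ := by
  simp [ext, ht]

/-- value of a digit vector: `Σ_t x_t M^t`. -/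
private def val (x : Fin d → ℕ) : ℕ := dsum M (ext d x) d

/-- digit vectors supported on `S` with digits in `[2, M-1]` there. -/
private def boxA (S : Finset (Fin d)) : Finset (Fin d → ℕ) :=
  Fintype.piFinset (fun t => if t ∈ S then Icc 2 (M - 1) else {0})

/-- digit vectors supported off `S` with digits in `[2, M-1]` there. -/
private def boxB (S : Finset (Fin d)) : Finset (Fin d → ℕ) :=
  Fintype.piFinset (fun t => if t ∈ S then {0} else Icc 2 (M - 1))

variable {M d}
/-- (helper for the digit design) [folklore] -/
private lemma mem_boxA {S : Finset (Fin d)} {x : Fin d → ℕ} :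
    x ∈ boxA M d S ↔ ∀ t, (t ∈ S → 2 ≤ x t ∧ x t ≤ M - 1) ∧ (t ∉ S → x t = 0) := by
  simp only [boxA, Fintype.mem_piFinset]
  refine ⟨fun h t => ?_, fun h t => ?_⟩ <;> by_cases ht : t ∈ S <;> have := h t <;>
    simp_all [mem_Icc]
/-- (helper for the digit design) [folklore] -/
private lemma mem_boxB {S : Finset (Fin d)} {y : Fin d → ℕ} :
    y ∈ boxB M d S ↔ ∀ t, (t ∈ S → y t = 0) ∧ (t ∉ S → 2 ≤ y t ∧ y t ≤ M - 1) := by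
  simp only [boxB, Fintype.mem_piFinset]
  refine ⟨fun h t => ?_, fun h t => ?_⟩ <;> by_cases ht : t ∈ S <;> have := h t <;>
    simp_all [mem_Icc]

/-- all digits of a box vector are `≤ M - 1`. -/
private lemma digit_le_of_mem_boxA {S : Finset (Fin d)} {x : Fin d → ℕ} (hx : x ∈ boxA M d S) (t : Fin d) :
    x t ≤ M - 1 := by
  rcases mem_boxA.mp hx t with ⟨h1, h2⟩
  by_cases ht : t ∈ S <;> [exact (h1 ht).2; (rw [h2 ht]; exact Nat.zero_le _)]
/-- (helper for the digit design) [folklore] -/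
private lemma digit_le_of_mem_boxB {S : Finset (Fin d)} {y : Fin d → ℕ} (hy : y ∈ boxB M d S) (t : Fin d) :
    y t ≤ M - 1 := by
  rcases mem_boxB.mp hy t with ⟨h1, h2⟩
  by_cases ht : t ∈ S <;> [(rw [h1 ht]; exact Nat.zero_le _); exact (h2 ht).2]
/-- (helper for the digit design) [folklore] -/
private lemma val_lt_pow (hM : 1 ≤ M) {x : Fin d → ℕ} (hx : ∀ t, x t ≤ M - 1) : val M d x < M ^ d := by
  exact dsum_lt_pow hM _ _ (fun t ht => by rw [ext_apply_lt d x ht]; exact hx _)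

/-- the digit-sum equation extracted from an SDPP relation between images in `ZMod p`. -/
private lemma nat_rel_of_zmod_rel {p : ℕ} {xa xa' yb yb' : ℕ} (h1 : xa + yb' < p) (h2 : xa' + yb < p)
    (h : ((xa : ZMod p) - (xa' : ZMod p)) + (-(yb : ZMod p) - -(yb' : ZMod p)) = 0) :
    xa + yb' = xa' + yb := by
  have h' : ((xa + yb' : ℕ) : ZMod p) = ((xa' + yb : ℕ) : ZMod p) := by
    push_cast; linear_combination h
  have := (ZMod.natCast_eq_natCast_iff' _ _ p).mp h'
  rwa [Nat.mod_eq_of_lt h1, Nat.mod_eq_of_lt h2] at this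

/-- **(W)** for the digit design: `x + y' = x' + y` digitwise forces `x = x'`, `y = y'`. -/
private lemma design_W (hM : 1 ≤ M) {S : Finset (Fin d)} {x x' y y' : Fin d → ℕ}
    (hx : x ∈ boxA M d S) (hx' : x' ∈ boxA M d S) (hy : y ∈ boxB M d S) (hy' : y' ∈ boxB M d S)
    (heq : val M d x + val M d y' = val M d x' + val M d y) : x = x' ∧ y = y' := by
  have hsum : dsum M (fun t => ext d x t + ext d y' t) d = dsum M (fun t => ext d x' t + ext d y t) d := by
    rw [dsum_add, dsum_add]; exact heq
  have hdig : ∀ (u : Fin d → ℕ) (v : Fin d → ℕ), u ∈ boxA M d S → v ∈ boxB M d S →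
      ∀ t < d, ext d u t + ext d v t ≤ M - 1 := by
    intro u v hu hv t ht
    rw [ext_apply_lt d u ht, ext_apply_lt d v ht]
    by_cases hts : (⟨t, ht⟩ : Fin d) ∈ S
    · rw [(mem_boxB.mp hv _).1 hts, add_zero]; exact ((mem_boxA.mp hu _).1 hts).2
    · rw [(mem_boxA.mp hu _).2 hts, zero_add]; exact ((mem_boxB.mp hv _).2 hts).2
  have hall := digits_eq_of_dsum_eq hM d _ _ (hdig x y' hx hy') (hdig x' y hx' hy) hsum
  have hpt : ∀ t : Fin d, x t = x' t ∧ y t = y' t := fun t => by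
    have h := hall t.val t.isLt
    simp only [ext_apply_fin] at h
    by_cases hts : t ∈ S
    · rw [(mem_boxB.mp hy' _).1 hts, (mem_boxB.mp hy _).1 hts] at h ⊢; simpa using h
    · rw [(mem_boxA.mp hx _).2 hts, (mem_boxA.mp hx' _).2 hts] at h ⊢; simpa using h.symm
  exact ⟨funext fun t => (hpt t).1, funext fun t => (hpt t).2⟩

/-- **(X)** for the digit design: if `|S| = |V|` and `x + y' = x' + y` in value with
`x ∈ boxA S`, `x' ∈ boxA U`, `y ∈ boxB U`, `y' ∈ boxB V`, then `S = V` — otherwise some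
`t₀ ∈ V ∖ S` is a zero digit of `x + y'` while `x' + y` has all digits in `[2, M-1]`. -/
private lemma design_X (hM : 2 ≤ M) {S U V : Finset (Fin d)} (hSV : S.card = V.card)
    {x x' y y' : Fin d → ℕ} (hx : x ∈ boxA M d S) (hx' : x' ∈ boxA M d U)
    (hy : y ∈ boxB M d U) (hy' : y' ∈ boxB M d V)
    (heq : val M d x + val M d y' = val M d x' + val M d y) : S = V := by
  by_contra hne
  have hex : ∃ t₀ ∈ V, t₀ ∉ S := by
    by_contra h
    push Not at h
    have hVS : V ⊆ S := fun t ht => h t ht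
    exact hne (Finset.eq_of_subset_of_card_le hVS (by rw [hSV])).symm
  obtain ⟨t₀, ht₀V, ht₀S⟩ := hex
  have hsum : dsum M (fun t => ext d x t + ext d y' t) d =
      dsum M (fun t => ext d x' t + ext d y t) d := by
    rw [dsum_add, dsum_add]; exact heq
  refine dsum_ne_of_zero_digit hM t₀.isLt (fun t => ext d x t + ext d y' t)
    (fun t => ext d x' t + ext d y t) ?_ ?_ ?_ hsum
  · intro t ht
    show ext d x t + ext d y' t ≤ 2 * M - 2
    rw [ext_apply_lt d x ht, ext_apply_lt d y' ht]
    have := digit_le_of_mem_boxA hx ⟨t, ht⟩; have := digit_le_of_mem_boxB hy' ⟨t, ht⟩; omega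
  · show ext d x t₀ + ext d y' t₀ = 0
    rw [ext_apply_fin, ext_apply_fin, (mem_boxA.mp hx t₀).2 ht₀S, (mem_boxB.mp hy' t₀).1 ht₀V]
  · intro t ht
    show 2 ≤ ext d x' t + ext d y t ∧ ext d x' t + ext d y t ≤ M - 1
    rw [ext_apply_lt d x' ht, ext_apply_lt d y ht]
    by_cases htU : (⟨t, ht⟩ : Fin d) ∈ U
    · rw [(mem_boxB.mp hy _).1 htU, add_zero]; exact (mem_boxA.mp hx' _).1 htU
    · rw [(mem_boxA.mp hx' _).2 htU, zero_add]; exact (mem_boxB.mp hy _).2 htU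

/-- digit vectors with digits `≤ M-1` are determined by their value. -/
private lemma eq_of_val_eq (hM : 1 ≤ M) {x x' : Fin d → ℕ} (hx : ∀ t, x t ≤ M - 1) (hx' : ∀ t, x' t ≤ M - 1)
    (h : val M d x = val M d x') : x = x' := by
  have hall := digits_eq_of_dsum_eq hM d (ext d x) (ext d x')
    (fun t ht => by rw [ext_apply_lt d x ht]; exact hx _)
    (fun t ht => by rw [ext_apply_lt d x' ht]; exact hx' _) h
  funext t; simpa [ext_apply_fin] using hall t.val t.isLt
/-- (helper for the digit design) [folklore] -/
private lemma card_boxA (S : Finset (Fin d)) : (boxA M d S).card = (M - 2) ^ S.card := by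
  rw [boxA, Fintype.card_piFinset]
  have h : ∀ t : Fin d, (if t ∈ S then Icc 2 (M - 1) else ({0} : Finset ℕ)).card =
      if t ∈ S then M - 2 else 1 := by
    intro t; split_ifs
    · rw [Nat.card_Icc]; omega
    · simp
  simp_rw [h]
  rw [Finset.prod_ite_mem, Finset.univ_inter, Finset.prod_const]
/-- (helper for the digit design) [folklore] -/
private lemma card_boxB (S : Finset (Fin d)) : (boxB M d S).card = (M - 2) ^ (d - S.card) := by
  rw [boxB, Fintype.card_piFinset]
  have h : ∀ t : Fin d, (if t ∈ S then ({0} : Finset ℕ) else Icc 2 (M - 1)).card =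
      if t ∈ Sᶜ then M - 2 else 1 := by
    intro t
    by_cases ht : t ∈ S
    · simp [ht]
    · rw [if_neg ht, if_pos (Finset.mem_compl.mpr ht), Nat.card_Icc]; omega
  simp_rw [h]
  rw [Finset.prod_ite_mem, Finset.univ_inter, Finset.prod_const, Finset.card_compl,
    Fintype.card_fin]

/-- **The radix-`M` digit design.** For `M ≥ 2`, `l`, and any `p ≥ 2·M^{2l}`, the
`binom(2l,l)` pairs `A_S = {Σ_{t∈S} x_t M^t : x_t ∈ [2,M-1]}`, `B_S = {−Σ_{t∉S} y_t M^t : y_t ∈ [2,M-1]}`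
(`S ⊆ Fin 2l`, `|S| = l`) form a balanced SDPP family in `ZMod p` with `s = (M-2)^l`. -/
private theorem digit_design (M l p : ℕ) (hM : 2 ≤ M) (hp : 2 * M ^ (2 * l) ≤ p) :
    ∃ A B : Fin ((2 * l).choose l) → Finset (ZMod p),
      (∀ i, (A i).card = (M - 2) ^ l ∧ (B i).card = (M - 2) ^ l) ∧
      (∀ i, ∀ a ∈ A i, ∀ a' ∈ A i, ∀ b ∈ B i, ∀ b' ∈ B i,
        (a - a') + (b - b') = 0 → a = a' ∧ b = b') ∧
      (∀ i j k, ∀ a ∈ A i, ∀ a' ∈ A j, ∀ b ∈ B j, ∀ b' ∈ B k,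
        (a - a') + (b - b') = 0 → i = k) := by
  set d := 2 * l with hd
  -- index the l-subsets of Fin d by Fin (d.choose l)
  set P : Finset (Finset (Fin d)) := powersetCard l (univ : Finset (Fin d)) with hP
  have hcardP : Fintype.card {S // S ∈ P} = d.choose l := by
    rw [Fintype.card_coe, hP, Finset.card_powersetCard, Finset.card_univ, Fintype.card_fin]
  let e : Fin (d.choose l) ≃ {S // S ∈ P} := (Fintype.equivFinOfCardEq hcardP).symm
  have hSl : ∀ i, ((e i).val).card = l := fun i =>
    (Finset.mem_powersetCard.mp (e i).property).2
  let f : (Fin d → ℕ) → ZMod p := fun x => ((val M d x : ℕ) : ZMod p)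
  let g : (Fin d → ℕ) → ZMod p := fun y => -((val M d y : ℕ) : ZMod p)
  have hM1 : 1 ≤ M := by omega
  have hvalp : ∀ x : Fin d → ℕ, (∀ t, x t ≤ M - 1) → 2 * val M d x < p := fun x hx => by
    have := val_lt_pow (d := d) hM1 hx; omega
  -- values of box vectors are told apart in `ZMod p`
  have hinj : ∀ x x' : Fin d → ℕ, (∀ t, x t ≤ M - 1) → (∀ t, x' t ≤ M - 1) →
      ((val M d x : ℕ) : ZMod p) = ((val M d x' : ℕ) : ZMod p) → x = x' := fun x x' hxd hxd' hxx => by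
    apply eq_of_val_eq hM1 hxd hxd'
    have := (ZMod.natCast_eq_natCast_iff' _ _ p).mp hxx
    rwa [Nat.mod_eq_of_lt (by have := hvalp x hxd; omega),
      Nat.mod_eq_of_lt (by have := hvalp x' hxd'; omega)] at this
  refine ⟨fun i => (boxA M d (e i).val).image f, fun i => (boxB M d (e i).val).image g, ?_, ?_, ?_⟩
  · -- cardinalities
    intro i
    constructor
    · rw [Finset.card_image_of_injOn, card_boxA, hSl]
      exact fun x hx x' hx' hxx => hinj x x' (digit_le_of_mem_boxA (Finset.mem_coe.mp hx))
        (digit_le_of_mem_boxA (Finset.mem_coe.mp hx')) hxx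
    · rw [Finset.card_image_of_injOn, card_boxB, hSl]
      · congr 1; omega
      exact fun y hy y' hy' hyy => hinj y y' (digit_le_of_mem_boxB (Finset.mem_coe.mp hy))
        (digit_le_of_mem_boxB (Finset.mem_coe.mp hy')) (neg_injective hyy)
  · -- (W)
    intro i a ha a' ha' b hb b' hb' hab
    simp only [Finset.mem_image] at ha ha' hb hb'
    obtain ⟨x, hx, rfl⟩ := ha; obtain ⟨x', hx', rfl⟩ := ha'
    obtain ⟨y, hy, rfl⟩ := hb; obtain ⟨y', hy', rfl⟩ := hb'
    have heq := nat_rel_of_zmod_rel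
      (by have := hvalp x (digit_le_of_mem_boxA hx); have := hvalp y' (digit_le_of_mem_boxB hy'); omega)
      (by have := hvalp x' (digit_le_of_mem_boxA hx'); have := hvalp y (digit_le_of_mem_boxB hy); omega)
      hab
    obtain ⟨rfl, rfl⟩ := design_W hM1 hx hx' hy hy' heq
    exact ⟨rfl, rfl⟩
  · -- (X)
    intro i j k a ha a' ha' b hb b' hb' hab
    simp only [Finset.mem_image] at ha ha' hb hb'
    obtain ⟨x, hx, rfl⟩ := ha; obtain ⟨x', hx', rfl⟩ := ha'
    obtain ⟨y, hy, rfl⟩ := hb; obtain ⟨y', hy', rfl⟩ := hb'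
    have heq := nat_rel_of_zmod_rel
      (by have := hvalp x (digit_le_of_mem_boxA hx); have := hvalp y' (digit_le_of_mem_boxB hy'); omega)
      (by have := hvalp x' (digit_le_of_mem_boxA hx'); have := hvalp y (digit_le_of_mem_boxB hy); omega)
      hab
    have hSV := design_X hM (by rw [hSl i, hSl k]) hx hx' hy hy' heq
    exact e.injective (Subtype.ext hSV)

end Design

/-! ## Corollaries -/

/-- `2^l ≤ binom(2l, l)`. -/
private lemma two_pow_le_centralBinom (l : ℕ) : 2 ^ l ≤ Nat.centralBinom l := by
  induction l with
  | zero => simp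
  | succ l ih =>
    have h := Nat.succ_mul_centralBinom_succ l
    -- (l+1) * C(l+1) = 2 * (2l+1) * C l ≥ 2 (l+1) C l
    have h2 : (l + 1) * (2 * Nat.centralBinom l) ≤ (l + 1) * Nat.centralBinom (l + 1) := by
      rw [h]; nlinarith [Nat.centralBinom_pos l]
    have h3 : 2 * Nat.centralBinom l ≤ Nat.centralBinom (l + 1) :=
      Nat.le_of_mul_le_mul_left h2 (by omega)
    calc 2 ^ (l + 1) = 2 * 2 ^ l := by ring
      _ ≤ 2 * Nat.centralBinom l := by omega
      _ ≤ Nat.centralBinom (l + 1) := h3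

/-- Refutes `FourierTwoFamilies.PrimeCyclicWall` [refuted-substantive] (stmt-MatrixMultiplication-5964):
there is no absolute `C` with `n·s² ≤ C·p` for balanced SDPP configurations in `ℤ/pℤ`.  Witness: the
radix-`9` digit designs (`binom(2l,l)` pairs of size `7^l`, SDPP in `ZMod p` for `p ≥ 2·81^l` by
`digit_design`) at a Bertrand prime `p ≤ 4·81^l` give `n·s² ≥ 98^l > 4C·81^l ≥ C·p` for
`l = ⌈81·4·max(C,1)/17⌉ + 1`.  No cheap repair: the ratio `n·s²/p` of this family grows like
`(196/81)^l/√l`, so neither a threshold `s ≥ s₀` nor any constant survives; the honest repairs are the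
live gen-2 items (power saving `n·s^{1+c} ≤ p` only for `c < 0.546`, log-decay, qualitative decay).
barrier-candidate: digit designs with digit set `[2, M-1]` realise CKSU Prop. 24 inside cyclic groups at
density `(4(M-2)/M²)^l`, so every SDPP density bound for cyclic hosts must allow `ρ ≥ s^{-0.546}`. [folklore] -/
theorem FourierTwoFamiliesPrimeCyclicWall_refuted :
    ¬ Summit.MatrixMultiplication.MatrixMultiplication.Theses.FourierTwoFamilies.PrimeCyclicWall := by
  rintro ⟨C, h⟩
  set C' : ℝ := max C 1 with hC'
  have hC'1 : 1 ≤ C' := le_max_right _ _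
  -- choose l with (98/81)^l > 4 C'
  set l : ℕ := ⌈81 * (4 * C') / 17⌉₊ + 1 with hl
  have hl_gt : 4 * C' < 1 + (l : ℝ) * (17 / 81) := by
    have : 81 * (4 * C') / 17 ≤ ⌈81 * (4 * C') / 17⌉₊ := Nat.le_ceil _
    have hl' : (l : ℝ) = (⌈81 * (4 * C') / 17⌉₊ : ℝ) + 1 := by rw [hl]; push_cast; ring
    rw [hl']; nlinarith
  have hbern : 1 + (l : ℝ) * (17 / 81) ≤ (1 + 17 / 81) ^ l := one_add_mul_le_pow (by norm_num) l
  have hgrow : 4 * C' * (81 : ℝ) ^ l < (98 : ℝ) ^ l := by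
    have : (98 : ℝ) ^ l = (1 + 17 / 81) ^ l * 81 ^ l := by rw [← mul_pow]; norm_num
    have h81 : (0 : ℝ) < 81 ^ l := by positivity
    rw [this]; nlinarith
  -- a Bertrand prime above 2·81^l
  obtain ⟨p, hp, hNp, hp4⟩ := Nat.exists_prime_lt_and_le_two_mul (2 * 9 ^ (2 * l)) (by positivity)
  obtain ⟨A, B, hbal, hW, hX⟩ := digit_design 9 l p (by norm_num) (le_of_lt hNp)
  have key := h p hp ((2 * l).choose l) ((9 - 2) ^ l) A B hbal hW hX
  -- n ≥ 2^l, s² = 49^l, p ≤ 4·81^l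
  have hn : (2 : ℝ) ^ l ≤ ((2 * l).choose l : ℕ) := by
    have := two_pow_le_centralBinom l; rw [Nat.centralBinom] at this; exact_mod_cast this
  have hs : (((9 - 2) ^ l : ℕ) : ℝ) ^ 2 = (49 : ℝ) ^ l := by
    push_cast; rw [← pow_mul, mul_comm, pow_mul]; norm_num
  have hp_le : (p : ℝ) ≤ 4 * (81 : ℝ) ^ l := by
    have : p ≤ 4 * 9 ^ (2 * l) := by omega
    have h' : (9 : ℝ) ^ (2 * l) = 81 ^ l := by rw [pow_mul]; norm_num
    calc (p : ℝ) ≤ ((4 * 9 ^ (2 * l) : ℕ) : ℝ) := by exact_mod_cast this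
      _ = 4 * 81 ^ l := by push_cast; rw [h']
  rw [hs] at key
  have h98 : (98 : ℝ) ^ l ≤ ((2 * l).choose l : ℕ) * (49 : ℝ) ^ l := by
    have : (98 : ℝ) ^ l = 2 ^ l * 49 ^ l := by rw [← mul_pow]; norm_num
    rw [this]; exact mul_le_mul_of_nonneg_right hn (by positivity)
  have : C * (p : ℝ) ≤ C' * p := mul_le_mul_of_nonneg_right (le_max_left _ _) (by positivity)
  nlinarith

end Summit.MatrixMultiplication.MatrixMultiplication.Theorems
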